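import Summits.HodgeConjecture.HodgeConjecture.Cruxes.BlochSeedDiscOne.SigmaH
import Summits.HodgeConjecture.HodgeConjecture.Cruxes.BlochSeedDiscOne.MinMassWindowH14
import Summits.HodgeConjecture.HodgeConjecture.Cruxes.BlochSeedDiscOne.AxisPhaseTorus

/-!
line stmt-HodgeConjecture-18881 Cruxes/BlochSeedDiscOne/Lines/birth.lean 814a6a70c14e831a stub_rung_pad4_seedAt

# OctagonCore — THE (A1)+μ CORE IS NEARLY FREE: the ROTATED OCTAGON `O₈` (8 cells, N-mass 4, rank 0, (A1)-clean, `μ = −192·i`) and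
# `O₂₀ := O₈ + 12·hub⁴`, which meets EVERY binder of the door of record `RuleDPlate.SPlus 14 sigmaH 0` EXCEPT `RuleD` at N-mass `16`
(plan-lens-HodgeAV-extremal g24, 2026-08-31; memo `DOOR-PRICE-extremal-g24.md` §2; sharpens the «door minus RuleD» inhabitants `D⋆(24)` ∕ `D°` ∕ `D◇`
(N-mass 40 ∕ 41 ∕ 40, `AxisRoomInhabitant24`, `OffAxisTwin`) from 40 to 16.)

HONESTY LABEL.  Letter-model statements about `DepthBoundA4.Design` only (Chern-character words on a letter model ≠ sheaves ≠ monads ≠ a SEED).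
NOTHING here is proved toward HC ∕ HC_CM ∕ HC_AV ∕ №4 ∕ 26512 ∕ 18881 ∕ H2; no rung, no shell of `SPlus 14 sigmaH 0` is closed; this is typed
EVIDENCE for the design-search lane (director-hodge R19.832 (D5)), not a rung.  CENSUS-NEUTRAL: `O₂₀` FAILS `RuleD` (certified, §4), so it
inhabits nothing of record and refutes nothing of record.

THE MECHANISM — MINIMAL ROTATED PAIR (an instance of `RotatedPairB136`'s rotated pair WITHOUT (A4) and without the S₀-orbit).
`O₈`:  N = the four UNIFORM cells `(ℓ_q,ℓ_q,ℓ_q,ℓ_q)`, `ℓ_q = i^q·(11;2,1)`;  P = the four uniform cells on `ℓ'_q = i^q·(11;1,2)` (unit multiplicities).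
All eight letters have ONE radial type `(a, |β|²) = (11, 5)`, so N and P have identical e-free data and every e-free word of `T(O₈)` vanishes;
the diagonal `C₄`-rotation kills every e-mixed word with `#ē − #e ≢ 0 (mod 4)`; the surviving `(1,1)`- and `(2,2)`-type words see only
`|β|² = 5` (uniform cells) and cancel N against P; and `μ = 4·((2−i)⁴ − (1−2i)⁴) = 4·((−7−24i) − (−7+24i)) = −192·i ≠ 0` because
`β⁴ ≠ β'⁴` — the two letters are MIRROR images, related by the rotation `(4+3i)/5` whose fourth power is not `1` (this needs an off-axis letter of
co-level ≥ 3: co-level-2 letters are axis or diagonal, where `β̄⁴ ∥ β⁴`).  `O₂₀ = O₈ + 12·(14;0,0)⁴`: the hub entry is weakly above every P-entry and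
carries the Hall surplus exactly (`4 + 8 = 12`: `HallPlusUp 8`, `¬ HallPlusUp 9`); `Disj` is plain; the Σ-H digits vanish (`sigmaH = 28·20 = 560`,
budget `560 + 28·(12−4) = 784 ≤ 3136`); `RuleD` fails at the charged N-cell `(ℓ₀,ℓ₀,ℓ₀,ℓ₀)` (no P-cell supplies its block `(0,1)`: RuleD's N-clause
needs a STRICTLY DEEPER P-cell and all cells of `O₂₀` have co-level ≤ 3).  So the door price `N* = min N-mass` (bracket of record `59 ≤ N* ≤ 6308`,
`AxisSPlus.nmass_ge_59` ∕ `AxisRuleDInhabitant`) is ENTIRELY the price of closing RULE D under (A1) above an (A1)+μ core that itself costs N-mass 4.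
§5 transports both designs to every height `h ≥ 3` (the core is `h`-free: ONE mechanism for h = 12 ∕ 14 ∕ 16).

KERNEL CERTIFICATE: one 625-row `decide +kernel` class table per design, `μ`, masses, alphabet ∕ Disj ∕ weak-arrow ∕ supplier ∕ Σ-H-digit tables by
`decide +kernel`; the Hall argument is structural (as `OffAxisTwin.hallPlusUp8_T`).  PROVENANCE (irrelevant to validity): `memo-24/code/door24.py`
(stdlib Python, exact integers).  `decide +kernel` ∕ `decide` only: no `native_decide`, no `sorry`, no `axiom`, no `instance`, no notation, no
Literature fact, no `allowUnsafeReducibility`.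
-/

set_option linter.dupNamespace false
set_option autoImplicit false
set_option maxRecDepth 16384
set_option maxHeartbeats 8000000

namespace Summit.HodgeConjecture.HodgeConjecture.Cruxes.BlochSeedDiscOne.OctagonCore

open Summit.HodgeConjecture.HodgeConjecture.Cruxes.BlochSeedDiscOne.DepthBoundA4
open Summit.HodgeConjecture.HodgeConjecture.Cruxes.BlochSeedDiscOne.HeightTower
open Summit.HodgeConjecture.HodgeConjecture.Cruxes.BlochSeedDiscOne.LeggedFloor (NullStep Supplies Detects RuleDP RuleD Disj)
open Summit.HodgeConjecture.HodgeConjecture.Cruxes.BlochSeedDiscOne.HallB136 (HallUp notDeadB weakLiveB weakLiveB_of)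
open Summit.HodgeConjecture.HodgeConjecture.Cruxes.BlochSeedDiscOne.RuleDPlate
  (HallPlusUp hallUp_of_hallPlusUp hallUp_shiftD hallPlusUp_shiftD disj_shiftD ruleD_shiftD BudgetClause budgetClause_shiftD SPlusB SPlus)
open Summit.HodgeConjecture.HodgeConjecture.Cruxes.BlochSeedDiscOne.SigmaH (sigmaH extPN extNP extNN extPP sigmaH_shiftD)
open Summit.HodgeConjecture.HodgeConjecture.Cruxes.BlochSeedDiscOne.MinMassWindowH14
  (toG rawT T_raw allB allB_iff anyB anyB_iff cellOf allWords mem_allWords efreeB efree_of_efreeB efreeB_of_efree blochB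
   bloch_of_blochB degB deg_eq_degB onAlphaB onAlphabet_of_B mem_suppN_of mem_suppP_of exists_of_mem_suppN exists_of_mem_suppP
   cellEqB cellEqB_self suppliesB suppliesB_of)
open Summit.HodgeConjecture.HodgeConjecture.Cruxes.BlochSeedDiscOne.AxisPhaseTorus (AxisCell AxisRoom)

/-! ## §1 Generic lemmas (verbatim from `OffAxisTwin` §1, which is not imported to keep the build light) -/

theorem notDead_of_notDeadB {ℓ ℓ' : Letter} (h : notDeadB ℓ ℓ' = true) : NotDead ℓ ℓ' := by
  simp only [notDeadB, Bool.or_eq_true, Bool.and_eq_true, decide_eq_true_eq] at h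
  rcases h with ⟨⟨ha, hx⟩, hy⟩ | ⟨ha, hb⟩
  · left
    obtain ⟨a, x, y⟩ := ℓ
    obtain ⟨a', x', y'⟩ := ℓ'
    simp only at ha hx hy
    subst ha; subst hx; subst hy
    rfl
  · right
    exact ⟨ha, by simpa only [pow_two] using hb⟩

theorem weakLive_of_weakLiveB {x y : Cell} (h : weakLiveB x y = true) : WeakLive x y := by
  simp only [weakLiveB, Bool.and_eq_true] at h
  obtain ⟨⟨⟨h0, h1⟩, h2⟩, h3⟩ := h
  intro f
  fin_cases f
  · exact notDead_of_notDeadB h0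
  · exact notDead_of_notDeadB h1
  · exact notDead_of_notDeadB h2
  · exact notDead_of_notDeadB h3

/-- axis cells are shift-invariant (the shift moves `a` only). -/
theorem axisCell_shiftCell (t : ℤ) (c : Cell) : AxisCell (shiftCell t c) ↔ AxisCell c := by
  simp only [AxisCell, shiftCell, Letter.isAxis, shiftL_x, shiftL_y]

theorem axisRoom_shiftD_iff (t : ℤ) (E : Design) : AxisRoom (shiftD t E) ↔ AxisRoom E := by
  constructor
  · intro hR c hc
    have hc' : shiftCell t c ∈ (shiftD t E).suppN ++ (shiftD t E).suppP := by
      rw [suppN_shift, suppP_shift, ← List.map_append]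
      exact List.mem_map.mpr ⟨c, hc, rfl⟩
    exact (axisCell_shiftCell t c).mp (hR _ hc')
  · intro hR c hc
    rw [suppN_shift, suppP_shift, ← List.map_append] at hc
    obtain ⟨c₀, hc₀, rfl⟩ := List.mem_map.mp hc
    exact (axisCell_shiftCell t c₀).mpr (hR c₀ hc₀)

/-! ## §2 The designs `O₈` and `O₂₀` at height 14 -/

/-- N-entries of `O₂₀`: `12·hub⁴`, then the four uniform cells on `i^q·(11;2,1)` (these four alone are the N-side of `O₈`). -/
def TN : List (Cell × ℕ) := [
  (cellOf ⟨14, 0, 0⟩ ⟨14, 0, 0⟩ ⟨14, 0, 0⟩ ⟨14, 0, 0⟩, 12),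
  (cellOf ⟨11, 2, 1⟩ ⟨11, 2, 1⟩ ⟨11, 2, 1⟩ ⟨11, 2, 1⟩, 1),
  (cellOf ⟨11, -1, 2⟩ ⟨11, -1, 2⟩ ⟨11, -1, 2⟩ ⟨11, -1, 2⟩, 1),
  (cellOf ⟨11, -2, -1⟩ ⟨11, -2, -1⟩ ⟨11, -2, -1⟩ ⟨11, -2, -1⟩, 1),
  (cellOf ⟨11, 1, -2⟩ ⟨11, 1, -2⟩ ⟨11, 1, -2⟩ ⟨11, 1, -2⟩, 1)]

/-- P-entries of `O₂₀` (= those of `O₈`): the four uniform cells on the MIRROR letters `i^q·(11;1,2)`. -/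
def TP : List (Cell × ℕ) := [
  (cellOf ⟨11, 1, 2⟩ ⟨11, 1, 2⟩ ⟨11, 1, 2⟩ ⟨11, 1, 2⟩, 1),
  (cellOf ⟨11, -2, 1⟩ ⟨11, -2, 1⟩ ⟨11, -2, 1⟩ ⟨11, -2, 1⟩, 1),
  (cellOf ⟨11, -1, -2⟩ ⟨11, -1, -2⟩ ⟨11, -1, -2⟩ ⟨11, -1, -2⟩, 1),
  (cellOf ⟨11, 2, -1⟩ ⟨11, 2, -1⟩ ⟨11, 2, -1⟩ ⟨11, 2, -1⟩, 1)]

/-- `O₂₀ = O₈ + 12·hub⁴` at height 14. -/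
def Doct : Design := ⟨TN, TP⟩

/-- the bare octagon `O₈` (no hub entry). -/
def Dcore : Design := ⟨TN.tail, TP⟩

/-- the hub cell `(14;0,0)⁴`. -/
def hub4 : Cell := cellOf ⟨14, 0, 0⟩ ⟨14, 0, 0⟩ ⟨14, 0, 0⟩ ⟨14, 0, 0⟩

/-- the charged N-cell `(ℓ₀,ℓ₀,ℓ₀,ℓ₀)`, `ℓ₀ = (11;2,1)` — fully off-axis; it is the RULE-D witness. -/
def y1 : Cell := cellOf ⟨11, 2, 1⟩ ⟨11, 2, 1⟩ ⟨11, 2, 1⟩ ⟨11, 2, 1⟩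

theorem hubE_mem : (hub4, 12) ∈ Doct.N := List.mem_cons_self

theorem y1_mem : (y1, 1) ∈ Doct.N := List.mem_cons_of_mem _ List.mem_cons_self

theorem y1_mem_core : (y1, 1) ∈ Dcore.N := List.mem_cons_self

/-! ## §3 Kernel computations -/

/-- class table of `O₂₀`: e-free words evaluate to `12·14^deg` (the hub entry alone: N and P octagon cells have identical e-free data),
every other word except the two Bloch words vanishes. -/
def rowT (w : Word) : Bool :=
  bif efreeB w then decide (rawT TN TP w = (12 * 14 ^ degB w, 0)) else (blochB w || decide (rawT TN TP w = (0, 0)))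

theorem tableT : allB allWords rowT = true := by decide +kernel

/-- class table of `O₈`: EVERY word except the two Bloch words vanishes (e-free rows included). -/
def rowC (w : Word) : Bool := blochB w || decide (rawT TN.tail TP w = (0, 0))

theorem tableC : allB allWords rowC = true := by decide +kernel

theorem mu_rawT : rawT TN TP Word.eeee = (0, -192) := by decide +kernel

theorem EEEE_rawT : rawT TN TP Word.EEEE = (0, 192) := by decide +kernel

theorem mu_rawC : rawT TN.tail TP Word.eeee = (0, -192) := by decide +kernel

theorem copies_T : Doct.copies = 20 := by decide +kernel

theorem rank_T : Doct.rank = 12 := by decide +kernel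

theorem massP_T : (Doct.P.map Prod.snd).sum = 4 := by decide +kernel

theorem massN_T : (Doct.N.map Prod.snd).sum = 16 := by decide +kernel

theorem copies_C : Dcore.copies = 8 := by decide +kernel

theorem rank_C : Dcore.rank = 0 := by decide +kernel

theorem massN_C : (Dcore.N.map Prod.snd).sum = 4 := by decide +kernel

theorem alphaTN : allB TN (fun cm => onAlphaB 14 cm.1) = true := by decide +kernel

theorem alphaTP : allB TP (fun cm => onAlphaB 14 cm.1) = true := by decide +kernel

/-- all letters have level `a ≥ 11` (used for the transport to every height `h ≥ 3`). -/
def levB (c : Cell) : Bool := decide (11 ≤ (c 0).a) && decide (11 ≤ (c 1).a) && decide (11 ≤ (c 2).a) && decide (11 ≤ (c 3).a)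

theorem levTN : allB TN (fun cm => levB cm.1) = true := by decide +kernel

theorem levTP : allB TP (fun cm => levB cm.1) = true := by decide +kernel

theorem disjT_table : allB TN (fun cn => allB TP (fun cm => !cellEqB cm.1 cn.1)) = true := by decide +kernel

/-- the hub entry is weakly above every P-entry … -/
theorem hub_above_P : allB TP (fun cm => weakLiveB cm.1 hub4) = true := by decide +kernel

/-- … and it is the whole weakly-live N-neighbourhood of the P-side (capacity `12`: tightness of the surplus). -/
def TD : List (Cell × ℕ) := Doct.N.filter fun cn => anyB TP (fun cm => weakLiveB cm.1 cn.1)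

theorem TD_capacity : (TD.map Prod.snd).sum = 12 := by decide +kernel

/-- no P-entry supplies the charged N-cell `y1` on the block `(0,1)`. -/
theorem y1_noSupplier : allB TP (fun cm => !suppliesB cm.1 y1 (0 : Fin 4) (1 : Fin 4)) = true := by decide +kernel

/-- Σ-H digits of `O₂₀`: no cross pair and no same-side pair sits in a priced degree. -/
theorem extPN_T_one : extPN Doct 1 = 0 := by decide +kernel
theorem extNP_T_three : extNP Doct 3 = 0 := by decide +kernel
theorem extNN_T_two : extNN Doct 2 = 0 := by decide +kernel
theorem extPP_T_two : extPP Doct 2 = 0 := by decide +kernel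

/-! ## §4 The certificates at height 14 -/

theorem onAlphabet_T : Doct.OnAlphabet 14 := by
  intro c hc f
  rcases List.mem_append.1 hc with hN | hP
  · obtain ⟨m, hm⟩ := exists_of_mem_suppN hN
    exact onAlphabet_of_B ((allB_iff _ _).1 alphaTN (c, m) hm) f
  · obtain ⟨m, hm⟩ := exists_of_mem_suppP hP
    exact onAlphabet_of_B ((allB_iff _ _).1 alphaTP (c, m) hm) f

theorem alphaTNtail : allB TN.tail (fun cm => onAlphaB 14 cm.1) = true := by decide +kernel

theorem onAlphabet_C : Dcore.OnAlphabet 14 := by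
  intro c hc f
  rcases List.mem_append.1 hc with hN | hP
  · obtain ⟨m, hm⟩ := exists_of_mem_suppN hN
    exact onAlphabet_of_B ((allB_iff _ _).1 alphaTNtail (c, m) hm) f
  · obtain ⟨m, hm⟩ := exists_of_mem_suppP hP
    exact onAlphabet_of_B ((allB_iff _ _).1 alphaTP (c, m) hm) f

theorem y1_suppN : y1 ∈ Doct.suppN := mem_suppN_of y1_mem (by decide)

theorem y1_suppN_core : y1 ∈ Dcore.suppN := mem_suppN_of y1_mem_core (by decide)

/-- **`O₂₀` is NOT in the axis room** (indeed every charged cell is fully off-axis). -/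
theorem not_axisRoom_T : ¬ AxisRoom Doct := by
  intro hR
  have h := hR y1 (List.mem_append_left _ y1_suppN) 0
  unfold Letter.isAxis at h
  revert h
  decide

theorem level_of_B {c : Cell} (hc : levB c = true) : ∀ f : Fin 4, 11 ≤ (c f).a := by
  simp only [levB, Bool.and_eq_true, decide_eq_true_eq] at hc
  obtain ⟨⟨⟨h0, h1⟩, h2⟩, h3⟩ := hc
  intro f
  fin_cases f
  · exact h0
  · exact h1
  · exact h2
  · exact h3

theorem level_T : ∀ c ∈ Doct.suppN ++ Doct.suppP, ∀ f : Fin 4, 11 ≤ (c f).a := by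
  intro c hc f
  rcases List.mem_append.1 hc with hN | hP
  · obtain ⟨m, hm⟩ := exists_of_mem_suppN hN
    exact level_of_B ((allB_iff _ _).1 levTN (c, m) hm) f
  · obtain ⟨m, hm⟩ := exists_of_mem_suppP hP
    exact level_of_B ((allB_iff _ _).1 levTP (c, m) hm) f

theorem T_closedT (w : Word) : Doct.T w = toG (rawT TN TP w) := T_raw Doct w

theorem T_closedC (w : Word) : Dcore.T w = toG (rawT TN.tail TP w) := T_raw Dcore w

/-- HUB ROWS of `O₂₀`: every e-free word evaluates to `12·14^{deg}`. -/
theorem efree_rows_T (w : Word) (hw : w.efree) : Doct.T w = ⟨12 * 14 ^ w.deg, 0⟩ := by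
  have hr := (allB_iff _ _).1 tableT w (mem_allWords w)
  unfold rowT at hr
  rw [efreeB_of_efree hw] at hr
  simp only [cond_true, decide_eq_true_eq] at hr
  rw [T_closedT, hr, deg_eq_degB]
  rfl

/-- MIXED ROWS of `O₂₀`: every e-mixed word other than the two Bloch words vanishes. -/
theorem mixed_rows_T (w : Word) (hne : ¬ w.efree) (h1 : w ≠ Word.eeee) (h2 : w ≠ Word.EEEE) : Doct.T w = 0 := by
  have hr := (allB_iff _ _).1 tableT w (mem_allWords w)
  unfold rowT at hr
  cases hb : efreeB w with
  | true => exact (hne (efree_of_efreeB hb)).elim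
  | false =>
    rw [hb] at hr
    simp only [cond_false, Bool.or_eq_true, decide_eq_true_eq] at hr
    rcases hr with hbl | hz
    · rcases bloch_of_blochB hbl with h | h
      · exact (h1 h).elim
      · exact (h2 h).elim
    · rw [T_closedT, hz]; ext <;> simp [toG]

/-- ALL ROWS of `O₈`: every word other than the two Bloch words vanishes. -/
theorem rows_C (w : Word) (h1 : w ≠ Word.eeee) (h2 : w ≠ Word.EEEE) : Dcore.T w = 0 := by
  have hr := (allB_iff _ _).1 tableC w (mem_allWords w)
  unfold rowC at hr
  simp only [Bool.or_eq_true, decide_eq_true_eq] at hr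
  rcases hr with hbl | hz
  · rcases bloch_of_blochB hbl with h | h
    · exact (h1 h).elim
    · exact (h2 h).elim
  · rw [T_closedC, hz]; ext <;> simp [toG]

theorem efree_ne_eeee (w : Word) (hw : w.efree) : w ≠ Word.eeee := by
  rintro rfl
  have h := efreeB_of_efree hw
  revert h
  decide

theorem efree_ne_EEEE (w : Word) (hw : w.efree) : w ≠ Word.EEEE := by
  rintro rfl
  have h := efreeB_of_efree hw
  revert h
  decide

/-- **`O₂₀` is (A1)-clean.** -/
theorem a1_T : Doct.A1 :=
  ⟨fun w hne h1 h2 => mixed_rows_T w hne h1 h2, fun w w' hw hw' hd => by rw [efree_rows_T w hw, efree_rows_T w' hw', hd]⟩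

/-- **`O₈` is (A1)-clean** (its whole class tensor is `μ·eeee + μ̄·ēēēē`). -/
theorem a1_C : Dcore.A1 :=
  ⟨fun w _ h1 h2 => rows_C w h1 h2, fun w w' hw hw' _ => by
    rw [rows_C w (efree_ne_eeee w hw) (efree_ne_EEEE w hw), rows_C w' (efree_ne_eeee w' hw') (efree_ne_EEEE w' hw')]⟩

theorem mu_T : Doct.mu = ⟨0, -192⟩ := by
  show Doct.T Word.eeee = _
  rw [T_closedT, mu_rawT]
  rfl

theorem mu_C : Dcore.mu = ⟨0, -192⟩ := by
  show Dcore.T Word.eeee = _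
  rw [T_closedC, mu_rawC]
  rfl

theorem mu_ne_T : Doct.mu ≠ 0 := by
  rw [mu_T]
  decide

theorem mu_ne_C : Dcore.mu ≠ 0 := by
  rw [mu_C]
  decide

theorem T_EEEE_T : Doct.T Word.EEEE = ⟨0, 192⟩ := by
  rw [T_closedT, EEEE_rawT]
  rfl

theorem disj_T : Disj Doct := by
  intro c hN hP
  obtain ⟨n, hn⟩ := exists_of_mem_suppN hN
  obtain ⟨m, hm⟩ := exists_of_mem_suppP hP
  have h1 := (allB_iff _ _).1 ((allB_iff _ _).1 disjT_table (c, n) hn) (c, m) hm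
  rw [cellEqB_self] at h1
  exact Bool.noConfusion h1

theorem disjC_table : allB TN.tail (fun cn => allB TP (fun cm => !cellEqB cm.1 cn.1)) = true := by decide +kernel

theorem disj_C : Disj Dcore := by
  intro c hN hP
  obtain ⟨n, hn⟩ := exists_of_mem_suppN hN
  obtain ⟨m, hm⟩ := exists_of_mem_suppP hP
  have h1 := (allB_iff _ _).1 ((allB_iff _ _).1 disjC_table (c, n) hn) (c, m) hm
  rw [cellEqB_self] at h1
  exact Bool.noConfusion h1

theorem hub_above (cm : Cell × ℕ) (hcm : cm ∈ Doct.P) : WeakLive cm.1 hub4 :=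
  weakLive_of_weakLiveB ((allB_iff _ _).1 hub_above_P cm hcm)

/-- **`O₂₀` satisfies PortHall₈**: every column set of positive mass is covered by the hub entry, and `mass S + 8 ≤ 4 + 8 = 12`. -/
theorem hallPlusUp8_T : HallPlusUp Doct 8 := by
  intro S hS hpos T hT hcov
  obtain ⟨cm, hcm⟩ : ∃ cm, cm ∈ S := by
    cases S with
    | nil => simp at hpos
    | cons a l => exact ⟨a, List.mem_cons_self⟩
  have hhub : (hub4, 12) ∈ T := hcov _ hubE_mem ⟨cm, hcm, hub_above cm (hS.subset hcm)⟩
  have h12 : 12 ≤ (T.map Prod.snd).sum :=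
    List.single_le_sum (fun a _ => Nat.zero_le a) 12 (List.mem_map.2 ⟨(hub4, 12), hhub, rfl⟩)
  have hle : (S.map Prod.snd).sum ≤ (Doct.P.map Prod.snd).sum := (hS.map Prod.snd).sum_le_sum (fun a _ => Nat.zero_le a)
  rw [massP_T] at hle
  omega

theorem hallUp_T : HallUp Doct := hallUp_of_hallPlusUp Doct 8 hallPlusUp8_T

theorem TD_sublist : TD.Sublist Doct.N := List.filter_sublist

theorem TD_covers : ∀ cn ∈ Doct.N, (∃ cm ∈ TP, WeakLive cm.1 cn.1) → cn ∈ TD := by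
  intro cn hcn hex
  obtain ⟨cm, hcm, hw⟩ := hex
  unfold TD
  exact List.mem_filter.2 ⟨hcn, (anyB_iff _ _).2 ⟨cm, hcm, weakLiveB_of hw⟩⟩

/-- **and the surplus is TIGHT**: `¬ HallPlusUp O₂₀ 9` (the P-side sees only the hub entry: `4 + 9 > 12`). -/
theorem not_hallPlusUp9_T : ¬ HallPlusUp Doct 9 := by
  intro h
  have h1 := h TP (List.Sublist.refl _) (by rw [show (TP.map Prod.snd).sum = 4 from massP_T]; decide) TD TD_sublist TD_covers
  rw [show (TP.map Prod.snd).sum = 4 from massP_T, TD_capacity] at h1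
  omega

theorem sigmaH_T : sigmaH Doct = 560 := by
  unfold sigmaH
  rw [copies_T, extPN_T_one, extNP_T_three, extNN_T_two, extPP_T_two]
  norm_num

/-- the Σ-budget of record holds with `2352` to spare: `560 + 28·(12 − 4) + 0 = 784 ≤ 3136`. -/
theorem budget_T : BudgetClause sigmaH 0 Doct := by
  unfold BudgetClause
  rw [sigmaH_T, rank_T]
  norm_num

theorem y1_detects : Detects y1 (0 : Fin 4) (1 : Fin 4) := by
  unfold Detects y1
  decide

/-- **`O₂₀` violates RULE D** (N-side clause) at the charged cell `y1`, block `(0,1)`. -/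
theorem not_ruleD_T : ¬ RuleD Doct := by
  intro h
  obtain ⟨x, hx, hs⟩ := h.1 y1 y1_suppN (0 : Fin 4) (1 : Fin 4) (by decide) y1_detects
  obtain ⟨m, hm⟩ := exists_of_mem_suppP hx
  have hb := (allB_iff _ _).1 y1_noSupplier (x, m) hm
  rw [suppliesB_of hs] at hb
  exact Bool.noConfusion hb

/-- `O₈` violates RULE D at the same cell (its P-side is that of `O₂₀`). -/
theorem not_ruleD_C : ¬ RuleD Dcore := by
  intro h
  obtain ⟨x, hx, hs⟩ := h.1 y1 y1_suppN_core (0 : Fin 4) (1 : Fin 4) (by decide) y1_detects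
  obtain ⟨m, hm⟩ := exists_of_mem_suppP hx
  have hb := (allB_iff _ _).1 y1_noSupplier (x, m) hm
  rw [suppliesB_of hs] at hb
  exact Bool.noConfusion hb

/-- **THE CORE `O₈`**: (A1)-clean, `μ = −192·i`, `Disj`, 8 cells, rank 0, N-mass 4 — the cheapest known (A1)+μ core (violates `RuleD`; no hub, so no Hall surplus). -/
theorem cert_C : Dcore.OnAlphabet 14 ∧ Disj Dcore ∧ Dcore.A1 ∧ Dcore.mu = ⟨0, -192⟩ ∧ Dcore.rank = 0 ∧ Dcore.copies = 8 ∧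
    (Dcore.N.map Prod.snd).sum = 4 ∧ (∀ w : Word, w ≠ Word.eeee → w ≠ Word.EEEE → Dcore.T w = 0) ∧ ¬ RuleD Dcore :=
  ⟨onAlphabet_C, disj_C, a1_C, mu_C, rank_C, copies_C, massN_C, rows_C, not_ruleD_C⟩

/-- **THE CERTIFICATE FOR `O₂₀` (height 14)**: every binder of `RuleDPlate.SPlus 14 sigmaH 0` except `RuleD`, off the axis room, rank 12,
20 copies, N-mass 16, `μ = −192·i`, Hall surplus exactly 8, Σ-H `560`, budget `784 ≤ 3136`. -/
theorem cert_T : Doct.OnAlphabet 14 ∧ ¬ AxisRoom Doct ∧ Disj Doct ∧ Doct.A1 ∧ HallUp Doct ∧ HallPlusUp Doct 8 ∧ Doct.mu = ⟨0, -192⟩ ∧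
    Doct.rank = 12 ∧ Doct.copies = 20 ∧ (Doct.N.map Prod.snd).sum = 16 ∧ sigmaH Doct = 560 ∧ BudgetClause sigmaH 0 Doct ∧
    (∀ w : Word, w.efree → Doct.T w = ⟨12 * 14 ^ w.deg, 0⟩) ∧ ¬ HallPlusUp Doct 9 ∧ ¬ RuleD Doct :=
  ⟨onAlphabet_T, not_axisRoom_T, disj_T, a1_T, hallUp_T, hallPlusUp8_T, mu_T, rank_T, copies_T, massN_T, sigmaH_T, budget_T, efree_rows_T,
    not_hallPlusUp9_T, not_ruleD_T⟩

/-- **RULE D CARRIES THE WHOLE PRICE**: the door sentence with `RuleD` deleted is inhabited at N-mass `16` — so NO N-mass law of the shape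
«door designs have N-mass ≥ 17» can hold without USING `RuleD` (sharpening `OffAxisTwin.not_nmassLaw_ruleDfree_offAxis`, which had 42). -/
theorem not_nmassLaw17_ruleDfree :
    ¬ (∀ D : Design, D.OnAlphabet 14 → Disj D → D.A1 → HallUp D → HallPlusUp D 8 → D.mu ≠ 0 → BudgetClause sigmaH 0 D →
        17 ≤ (D.N.map Prod.snd).sum) := by
  intro H
  have h := H Doct onAlphabet_T disj_T a1_T hallUp_T hallPlusUp8_T mu_ne_T budget_T
  rw [massN_T] at h
  omega

theorem not_ruleDfree_door_offAxis16 :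
    ¬ (∀ D : Design, D.OnAlphabet 14 → ¬ AxisRoom D → Disj D → D.A1 → HallUp D → HallPlusUp D 8 → D.mu ≠ 0 →
        BudgetClause sigmaH 0 D → 17 ≤ (D.N.map Prod.snd).sum) := by
  intro H
  have h := H Doct onAlphabet_T not_axisRoom_T disj_T a1_T hallUp_T hallPlusUp8_T mu_ne_T budget_T
  rw [massN_T] at h
  omega

/-! ## §5 Every height `h ≥ 3` (transport by `HeightTower.shiftD (h − 14)`): the core is `h`-free -/

/-- `O₂₀` transported to height `h` (letters `i^q·(h−3;2,1)` ∕ `i^q·(h−3;1,2)` and `12·(h;0,0)⁴`). -/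
def DoctAt (h : ℤ) : Design := shiftD (h - 14) Doct

theorem onAlphabet_DoctAt {h : ℤ} (hh : 3 ≤ h) : (DoctAt h).OnAlphabet h := by
  have e : h = 14 + (h - 14) := by ring
  rw [DoctAt, e, add_sub_cancel_left]
  exact onAlphabet_shift Doct 14 (h - 14) onAlphabet_T (fun c hc f => by have := level_T c hc f; omega)

/-- **`O₂₀` AT EVERY HEIGHT `h ≥ 3`**: all binders of the door of record except `RuleD`, off the axis room, rank 12, 20 copies (N-mass 16), `μ = −192·i`. -/
theorem cert_DoctAt {h : ℤ} (hh : 3 ≤ h) :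
    (DoctAt h).OnAlphabet h ∧ ¬ AxisRoom (DoctAt h) ∧ Disj (DoctAt h) ∧ (DoctAt h).A1 ∧ HallUp (DoctAt h) ∧
    HallPlusUp (DoctAt h) 8 ∧ (DoctAt h).mu = ⟨0, -192⟩ ∧ (DoctAt h).rank = 12 ∧ (DoctAt h).copies = 20 ∧
    BudgetClause sigmaH 0 (DoctAt h) ∧ ¬ RuleD (DoctAt h) := by
  refine ⟨onAlphabet_DoctAt hh, fun hR => not_axisRoom_T ((axisRoom_shiftD_iff _ _).mp hR), (disj_shiftD _ _).mpr disj_T,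
    a1_shiftD _ _ a1_T, (hallUp_shiftD _ _).mpr hallUp_T, (hallPlusUp_shiftD _ _ 8).mpr hallPlusUp8_T, ?_, ?_, ?_, ?_, ?_⟩
  · rw [DoctAt, mu_shiftD, mu_T]
  · rw [DoctAt, rank_shift, rank_T]
  · rw [DoctAt, copies_shift, copies_T]
  · exact (budgetClause_shiftD sigmaH 0 sigmaH_shiftD _ _).mpr budget_T
  · exact fun hr => not_ruleD_T ((ruleD_shiftD _ _).mp hr)

/-- **AT EVERY HEIGHT `h ≥ 3`, NO RULE-D-FREE N-MASS LAW BEYOND 16.** -/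
theorem not_nmassLaw17_ruleDfree_at {h : ℤ} (hh : 3 ≤ h) :
    ¬ (∀ D : Design, D.OnAlphabet h → Disj D → D.A1 → HallUp D → HallPlusUp D 8 → D.mu ≠ 0 → BudgetClause sigmaH 0 D →
        17 ≤ (D.N.map Prod.snd).sum) := by
  intro H
  obtain ⟨hA, _, hd, h1, hu, hp, hμ, hr, hc, hb, _⟩ := cert_DoctAt hh
  have hm := H (DoctAt h) hA hd h1 hu hp (by rw [hμ]; decide) hb
  have e : ((DoctAt h).N.map Prod.snd).sum + ((DoctAt h).P.map Prod.snd).sum = 20 := hc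
  have e2 : (((DoctAt h).N.map Prod.snd).sum : ℤ) - (((DoctAt h).P.map Prod.snd).sum : ℤ) = 12 := hr
  omega

end Summit.HodgeConjecture.HodgeConjecture.Cruxes.BlochSeedDiscOne.OctagonCore
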